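import Literature.Probability.RandomPlanarGeometry.RadialBesselMarkov
import HarnessLib

/-!
# Dynkin-type identities for exit functionals of the radial Bessel process

Topic `Probability/RandomPlanarGeometry`; theorems only, sequel of `RadialBesselMarkov`. For the
SLE_κ radial Bessel process `Y = Y^θ` (LSW (2002), (2.9)–(2.11)) with lifetime `T` and top exit
event `{Y_T = 2π}`, and for `a_ψ(y) = E^y[ψ(T); Y_T = 2π]` (`topExpect`), `b_ψ(y) = E^y[ψ(T); Y_T = 0]`
(`botExpect`), we prove, for every stopping time `ρ ≤ σₙ(θ)` of the raw Brownian filtration: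

* `integral_topExpect_stoppedValue_eq` — **mean-value property**
  `E[a_ψ(Y_ρ)] = E[ψ(T - ρ); Y_T = 2π]` (and `…botExpect…`);
* `integral_intervalIntegral_topExpect_eq` — **Dynkin's formula for `a_ψ`**, `ψ ∈ C¹` with `ψ, ψ'`
  bounded: `E[∫₀^ρ a_{ψ'}(Y_v) dv] = a_ψ(θ) - E[a_ψ(Y_ρ)]` (and `…botExpect…`).

The second identity says that `a_ψ(Y_{t∧ρ}) + ∫₀^{t∧ρ} a_{ψ'}(Y_v) dv` has constant expectation —
the integrated form of "`(κ/2) a_ψ'' + cot(θ/2) a_ψ' = -a_{ψ'}`", i.e. of LSW's PDE (2.4) for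
`h(θ, t) = E^θ[φ(t - T); ·]` in the space variable, obtained here WITHOUT any regularity of `a_ψ`:
by Fubini, the fixed-time strong Markov property
`E[a_{ψ'}(Y_v); v < ρ] = E[ψ'(T - v); Y_T = 2π, v < ρ]` (`RadialBesselMarkov`), and the fundamental
theorem of calculus `∫₀^ρ ψ'(T - v) dv = ψ(T) - ψ(T - ρ)`. It is the probabilistic input of the
regularity theorem for `a_ψ` (comparison with the solution of the two-point boundary value problem,
`RadialBesselHarmonic`), which replaces the appeal to "the theory of diffusion processes" in LSW's
proof of Lemma 2.2 (p. 6).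

## References

* G. F. Lawler, O. Schramm, W. Werner, *One-arm exponent for critical 2D percolation*, Electron.
  J. Probab. 7 (2002), no. 2, §2, proof of Lemma 2.2 (p. 6). [LawlerSchrammWernerEJP2002]
* D. Revuz, M. Yor, *Continuous Martingales and Brownian Motion* (1999), Ch. VII, Prop. (1.2)
  (Dynkin's formula). [RevuzYor1999]
-/

noncomputable section

open MeasureTheory ProbabilityTheory Filter Topology Set
open scoped NNReal ENNReal

namespace Literature.Probability.RandomPlanarGeometry

namespace RadialLoewner

open Literature.Probability.Process

variable {κ : ℝ≥0} {n : ℕ} {θ : ℝ}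

/-! ### Integrability of the lifetime and of the times before it -/

/-- **The lifetime is integrable** (`κ > 4`; it has exponential moments, `RadialBesselLifetime`).
[cite: Lawler2005, §1.11 Lemma 1.27] -/
theorem integrable_sleLifetimeReal (hκ : 4 < κ) : Integrable (sleLifetimeReal κ θ) preWienerMeasure := by
  have hr : 0 < tailRate κ / 2 := half_pos (tailRate_pos hκ)
  have hexp := integrable_exp_mul_sleLifetimeReal (θ := θ) hκ hr.le (half_lt_self (tailRate_pos hκ))
  refine (hexp.const_mul (1 / (tailRate κ / 2))).mono'
    (measurable_sleLifetimeReal κ θ).aestronglyMeasurable (Eventually.of_forall fun ω ↦ ?_)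
  rw [Real.norm_eq_abs, abs_of_nonneg (sleLifetimeReal_nonneg κ θ ω), one_div, inv_mul_eq_div,
    le_div_iff₀ hr]
  have h := Real.add_one_le_exp (tailRate κ / 2 * sleLifetimeReal κ θ ω)
  linarith

/-- The real reading of an extended time. [folklore] -/
theorem coe_untopA_of_eq_coe {x : WithTop ℝ≥0} {r : ℝ≥0} (h : x = r) : ((x.untopA : ℝ≥0) : ℝ) = r := by
  rw [h]; rfl

/-- A time `ρ ≤ σₙ` is a.s. at most the lifetime, in `ℝ`. [folklore] -/
theorem untopA_le_sleLifetimeReal_ae (hκ : 4 < κ) {ρ : (ℝ≥0 → ℝ) → WithTop ℝ≥0}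
    (hρσ : ∀ ω, ρ ω ≤ sleExitLevel κ n θ ω) :
    ∀ᵐ ω ∂preWienerMeasure, (((ρ ω).untopA : ℝ≥0) : ℝ) ≤ sleLifetimeReal κ θ ω := by
  filter_upwards [ae_sleLifetime_lt_top (κ := κ) (θ := θ) hκ] with ω hT
  obtain ⟨t, ht⟩ := WithTop.ne_top_iff_exists.1 hT.ne
  have hle : ρ ω ≤ sleLifetime κ θ ω :=
    (hρσ ω).trans (exitLevel_le_lifetime (continuous_sleDriving' κ) n θ ω)
  rw [← ht] at hle
  obtain ⟨r, hr⟩ := WithTop.ne_top_iff_exists.1 (ne_top_of_le_ne_top WithTop.coe_ne_top hle)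
  rw [← hr, WithTop.coe_le_coe] at hle
  rw [sleLifetimeReal_of_eq_coe ht.symm, coe_untopA_of_eq_coe hr.symm]
  exact_mod_cast hle

/-- **A stopping time before `σₙ` is integrable** (read in `ℝ`). [folklore] -/
theorem integrable_untopA_of_le_sleExitLevel (hκ : 4 < κ) {ρ : (ℝ≥0 → ℝ) → WithTop ℝ≥0}
    (hρ : IsStoppingTime brownianFiltration ρ) (hρσ : ∀ ω, ρ ω ≤ sleExitLevel κ n θ ω) :
    Integrable (fun ω ↦ (((ρ ω).untopA : ℝ≥0) : ℝ)) preWienerMeasure := by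
  refine (integrable_sleLifetimeReal (θ := θ) hκ).mono'
    (hρ.measurable'.untopA.coe_nnreal_real.aestronglyMeasurable) ?_
  filter_upwards [untopA_le_sleLifetimeReal_ae hκ hρσ] with ω hω
  rw [Real.norm_eq_abs, abs_of_nonneg (NNReal.coe_nonneg _)]
  exact hω

/-! ### Fubini for a time integral up to a random time -/

/-- **Fubini for `∫₀^R`**: for a nonnegative integrable random time `R` and a bounded jointly
measurable integrand `φ(ω, v)`, the random interval integral `∫₀^{R(ω)} φ(ω, v) dv` is integrable
and `E[∫₀^R φ(·, v) dv] = ∫ E[φ(·, v); v < R] dv`. [folklore] -/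
theorem integral_intervalIntegral_eq_integral_integral {R : (ℝ≥0 → ℝ) → ℝ} (hRm : Measurable R)
    (hR0 : ∀ ω, 0 ≤ R ω) (hRi : Integrable R preWienerMeasure)
    {φ : (ℝ≥0 → ℝ) → ℝ → ℝ} (hφm : Measurable (Function.uncurry φ)) {K : ℝ}
    (hφb : ∀ ω v, |φ ω v| ≤ K) :
    Integrable (fun ω ↦ ∫ v in (0 : ℝ)..R ω, φ ω v) preWienerMeasure ∧
      ∫ ω, (∫ v in (0 : ℝ)..R ω, φ ω v) ∂preWienerMeasure =
        ∫ v, ∫ ω, (Ioo 0 (R ω)).indicator (φ ω) v ∂preWienerMeasure := by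
  haveI := isProbabilityMeasure_preWienerMeasure'
  have hK : 0 ≤ K := (abs_nonneg _).trans (hφb (fun _ ↦ 0) 0)
  -- the integrand on the product space
  set E : Set ((ℝ≥0 → ℝ) × ℝ) := {p | 0 < p.2} ∩ {p | p.2 < R p.1} with hE
  have hEm : MeasurableSet E :=
    (measurableSet_lt measurable_const measurable_snd).inter
      (measurableSet_lt measurable_snd (hRm.comp measurable_fst))
  set g : (ℝ≥0 → ℝ) × ℝ → ℝ := E.indicator (Function.uncurry φ) with hg
  have hg_eq : ∀ ω v, g (ω, v) = (Ioo 0 (R ω)).indicator (φ ω) v := by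
    intro ω v
    by_cases hv : v ∈ Ioo 0 (R ω)
    · rw [indicator_of_mem hv, hg, indicator_of_mem (show (ω, v) ∈ E from hv)]; rfl
    · rw [indicator_of_notMem hv, hg, indicator_of_notMem (show (ω, v) ∉ E from hv)]
  have hgm : Measurable g := hφm.indicator hEm
  -- slices and the measure of `E`
  have hslice : ∀ ω, Prod.mk ω ⁻¹' E = Ioo 0 (R ω) := fun ω ↦ by
    ext v; simp [hE]
  have hEmeas : (preWienerMeasure.prod volume) E = ∫⁻ ω, ENNReal.ofReal (R ω) ∂preWienerMeasure := by
    rw [Measure.prod_apply hEm]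
    refine lintegral_congr fun ω ↦ ?_
    rw [hslice, Real.volume_Ioo, sub_zero]
  have hElt : (preWienerMeasure.prod volume) E < ⊤ := by
    rw [hEmeas]
    exact ((hasFiniteIntegral_iff_ofReal (Eventually.of_forall hR0)).1 hRi.hasFiniteIntegral)
  -- integrability of `g`
  have hgi : Integrable g (preWienerMeasure.prod volume) := by
    refine Integrable.mono' (g := fun p ↦ K * E.indicator (fun _ ↦ (1 : ℝ)) p) ?_ hgm.aestronglyMeasurable
      (Eventually.of_forall fun p ↦ ?_)
    · exact ((integrable_indicator_iff hEm).2 (integrableOn_const (hs := hElt.ne) (hC := by simp))).const_mul K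
    · rw [hg]
      by_cases hp : p ∈ E
      · rw [indicator_of_mem hp, indicator_of_mem hp, Real.norm_eq_abs, mul_one]
        exact hφb p.1 p.2
      · rw [indicator_of_notMem hp, indicator_of_notMem hp, norm_zero, mul_zero]
  -- the inner integral in `v` is the interval integral
  have hinner : ∀ ω, ∫ v, g (ω, v) = ∫ v in (0 : ℝ)..R ω, φ ω v := by
    intro ω
    simp_rw [hg_eq ω]
    rw [integral_indicator measurableSet_Ioo, intervalIntegral.integral_of_le (hR0 ω),
      integral_Ioc_eq_integral_Ioo]
  constructor
  · have h := hgi.integral_prod_left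
    simp_rw [hinner] at h
    exact h
  · have hgi' : Integrable (Function.uncurry fun (ω : ℝ≥0 → ℝ) (v : ℝ) ↦ g (ω, v))
        (preWienerMeasure.prod volume) := hgi
    have hswap := integral_integral_swap hgi'
    simp_rw [hinner] at hswap
    rw [hswap]
    refine integral_congr_ae (Eventually.of_forall fun v ↦ ?_)
    simp_rw [hg_eq]

/-! ### The level-`n` flow at real times -/

/-- The level-`n` flow read at real times `v ↦ Y_{v⁺}` is jointly measurable in `(ω, v)`.
[folklore] -/
theorem measurable_sleArgLevel_toNNReal_uncurry (κ : ℝ≥0) (n : ℕ) (θ : ℝ) :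
    Measurable fun p : (ℝ≥0 → ℝ) × ℝ ↦ sleArgLevel κ n θ p.2.toNNReal p.1 := by
  have h := measurable_uncurry_of_continuous_of_measurable
    (u := fun (v : ℝ) (ω : ℝ≥0 → ℝ) ↦ sleArgLevel κ n θ v.toNNReal ω)
    (fun ω ↦ (continuous_sleArgLevel κ n θ ω).comp continuous_real_toNNReal)
    (fun v ↦ (adapted_sleArgLevel κ n θ v.toNNReal).mono (brownianFiltration.le _) le_rfl)
  exact Measurable.comp (g := Function.uncurry fun (v : ℝ) (ω : ℝ≥0 → ℝ) ↦ sleArgLevel κ n θ v.toNNReal ω)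
    (f := Prod.swap) h measurable_swap

/-- On `{ρ = r}`, a real time `v > 0` is `< r` iff `v⁺ < ρ` as extended times. [folklore] -/
theorem lt_untopA_iff {ρ : (ℝ≥0 → ℝ) → WithTop ℝ≥0} {ω : ℝ≥0 → ℝ} {r : ℝ≥0} (hr : ρ ω = r)
    {v : ℝ} (hv : 0 < v) : v < (((ρ ω).untopA : ℝ≥0) : ℝ) ↔ ((v.toNNReal : ℝ≥0) : WithTop ℝ≥0) < ρ ω := by
  rw [coe_untopA_of_eq_coe hr, hr, WithTop.coe_lt_coe, ← NNReal.coe_lt_coe, Real.coe_toNNReal _ hv.le]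

section Top

variable (hκ : 4 < κ) (hθn : θ ∈ Ioo (2 * level n) (2 * Real.pi - 2 * level n))
  {ρ : (ℝ≥0 → ℝ) → WithTop ℝ≥0} (hρ : IsStoppingTime brownianFiltration ρ)
  (hρσ : ∀ ω, ρ ω ≤ sleExitLevel κ n θ ω)
include hκ hθn hρ hρσ

omit hκ hθn hρσ in
/-- `{v < ρ}` is an event of `𝓕_{ρ ∧ v}`. [folklore] -/
theorem measurableSet_lt_min_const (v : ℝ≥0) :
    MeasurableSet[(hρ.min_const v).measurableSpace] {ω | (v : WithTop ℝ≥0) < ρ ω} := by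
  have h : {ω : ℝ≥0 → ℝ | (v : WithTop ℝ≥0) < ρ ω} = {ω | ρ ω ≤ v}ᶜ := by ext ω; simp
  rw [h]
  exact ((hρ.measurableSet_min_const_iff _).2 ⟨hρ.measurableSet_le' v, hρ.measurableSet_le v⟩).compl

/-- **Fixed-time strong Markov property, top exit**: for `v ≥ 0` and bounded measurable `ψ`,
`E[a_ψ(Y_v); v < ρ] = E[ψ(T - v); Y_T = 2π, v < ρ]` (the strong Markov property at `ρ ∧ v` with
the `𝓕_{ρ∧v}`-event `{v < ρ}`). [cite: LawlerSchrammWernerEJP2002, §2 (2.10)] -/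
theorem integral_indicator_lt_mul_topExpect_eq {ψ : ℝ → ℝ} (hψm : Measurable ψ) {C : ℝ}
    (hψb : ∀ t, |ψ t| ≤ C) (v : ℝ≥0) :
    ∫ ω, {ω | (v : WithTop ℝ≥0) < ρ ω}.indicator 1 ω * topExpect κ ψ (sleArgLevel κ n θ v ω)
        ∂preWienerMeasure =
      ∫ ω, {ω | (v : WithTop ℝ≥0) < ρ ω}.indicator 1 ω *
        (sleExitsTop κ θ).indicator (fun ω ↦ ψ (sleLifetimeReal κ θ ω - v)) ω ∂preWienerMeasure := by
  have hρv := hρ.min_const v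
  have hρvσ : ∀ ω, min (ρ ω) v ≤ sleExitLevel κ n θ ω := fun ω ↦ (min_le_left _ _).trans (hρσ ω)
  set A := {ω : ℝ≥0 → ℝ | (v : WithTop ℝ≥0) < ρ ω} with hA
  have hG : Measurable[hρv.measurableSpace] (A.indicator fun _ : ℝ≥0 → ℝ ↦ (1 : ℝ)) :=
    (measurable_const (a := (1 : ℝ))).indicator (measurableSet_lt_min_const hρ v)
  have hGb : ∀ ω, |A.indicator (fun _ : ℝ≥0 → ℝ ↦ (1 : ℝ)) ω| ≤ 1 := fun ω ↦ by
    by_cases h : ω ∈ A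
    · rw [indicator_of_mem h]; simp
    · rw [indicator_of_notMem h]; simp
  have h := integral_mul_indicator_exitsTop_comp_sub_eq hκ hθn hρv hρvσ hG hGb hψm hψb
  -- identify both integrands on `A` (off `A` they vanish)
  have hL : ∀ ω, A.indicator (fun _ : ℝ≥0 → ℝ ↦ (1 : ℝ)) ω * (sleExitsTop κ θ).indicator
      (fun ω ↦ ψ (sleLifetimeReal κ θ ω - (((min (ρ ω) v).untopA : ℝ≥0) : ℝ))) ω =
      A.indicator 1 ω * (sleExitsTop κ θ).indicator (fun ω ↦ ψ (sleLifetimeReal κ θ ω - v)) ω := by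
    intro ω
    by_cases hω : ω ∈ A
    · have hmin : min (ρ ω) v = (v : WithTop ℝ≥0) := min_eq_right (le_of_lt hω)
      by_cases hS : ω ∈ sleExitsTop κ θ
      · rw [indicator_of_mem hS, indicator_of_mem hS, coe_untopA_of_eq_coe hmin]; rfl
      · rw [indicator_of_notMem hS, indicator_of_notMem hS]; rfl
    · rw [indicator_of_notMem hω, indicator_of_notMem hω, zero_mul, zero_mul]
  have hR : ∀ ω, A.indicator (fun _ : ℝ≥0 → ℝ ↦ (1 : ℝ)) ω *
      topExpect κ ψ (stoppedValue (sleArgLevel κ n θ) (fun ω ↦ min (ρ ω) v) ω) =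
      A.indicator 1 ω * topExpect κ ψ (sleArgLevel κ n θ v ω) := by
    intro ω
    by_cases hω : ω ∈ A
    · have hmin : min (ρ ω) v = (v : WithTop ℝ≥0) := min_eq_right (le_of_lt hω)
      have : stoppedValue (sleArgLevel κ n θ) (fun ω ↦ min (ρ ω) v) ω = sleArgLevel κ n θ v ω := by
        rw [stoppedValue]
        simp only [hmin]
        rfl
      rw [this]; rfl
    · rw [indicator_of_notMem hω, indicator_of_notMem hω, zero_mul, zero_mul]
  simp_rw [hL, hR] at h
  exact h.symm

/-- **Mean-value property, top exit**: `E[a_ψ(Y_ρ)] = E[ψ(T - ρ); Y_T = 2π]` for a stopping time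
`ρ ≤ σₙ(θ)` (the conditional law of `(T - ρ, 1_{Y_T = 2π})` given `𝓕_ρ` is that of `(T, 1_{Y_T = 2π})`
under `P^{Y_ρ}`; LSW (2002), (2.10) with `t = 0`). [cite: LawlerSchrammWernerEJP2002, §2 (2.10)] -/
theorem integral_topExpect_stoppedValue_eq {ψ : ℝ → ℝ} (hψm : Measurable ψ) {C : ℝ}
    (hψb : ∀ t, |ψ t| ≤ C) :
    ∫ ω, topExpect κ ψ (stoppedValue (sleArgLevel κ n θ) ρ ω) ∂preWienerMeasure =
      ∫ ω, (sleExitsTop κ θ).indicator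
        (fun ω ↦ ψ (sleLifetimeReal κ θ ω - ((ρ ω).untopA : ℝ≥0))) ω ∂preWienerMeasure := by
  have hG : Measurable[hρ.measurableSpace] (fun _ : ℝ≥0 → ℝ ↦ (1 : ℝ)) := measurable_const (a := (1 : ℝ))
  have h := integral_mul_indicator_exitsTop_comp_sub_eq hκ hθn hρ hρσ hG (C' := 1)
    (fun _ ↦ by simp) hψm hψb
  simp only [one_mul] at h
  exact h.symm

/-- **Dynkin's formula for `a_ψ`, top exit.** For `ψ ∈ C¹(ℝ)` with `ψ` and `ψ'` bounded (`ψ'`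
continuous) and a stopping time `ρ ≤ σₙ(θ)`,
`E[∫₀^ρ a_{ψ'}(Y_v) dv] = a_ψ(θ) - E[a_ψ(Y_ρ)]`, where `a_φ(y) = E^y[φ(T); Y_T = 2π]`. Proof: Fubini
in `(ω, v)`; for fixed `v`, `E[a_{ψ'}(Y_v); v < ρ] = E[ψ'(T - v); Y_T = 2π, v < ρ]` (fixed-time strong
Markov property); Fubini back and `∫₀^ρ ψ'(T - v) dv = ψ(T) - ψ(T - ρ)`; finally the mean-value
property `E[ψ(T - ρ); Y_T = 2π] = E[a_ψ(Y_ρ)]`. This is the integrated form of LSW's PDE (2.4) in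
the space variable for `h = a_ψ`, with no regularity of `a_ψ` assumed.
[cite: LawlerSchrammWernerEJP2002, §2 proof of Lemma 2.2] -/
theorem integral_intervalIntegral_topExpect_eq {ψ ψ' : ℝ → ℝ} (hψ : ∀ t, HasDerivAt ψ (ψ' t) t)
    (hψ'c : Continuous ψ') {C C' : ℝ} (hψb : ∀ t, |ψ t| ≤ C) (hψ'b : ∀ t, |ψ' t| ≤ C') :
    ∫ ω, (∫ v in (0 : ℝ)..(((ρ ω).untopA : ℝ≥0) : ℝ), topExpect κ ψ' (sleArgLevel κ n θ v.toNNReal ω))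
        ∂preWienerMeasure =
      topExpect κ ψ θ - ∫ ω, topExpect κ ψ (stoppedValue (sleArgLevel κ n θ) ρ ω) ∂preWienerMeasure := by
  haveI := isProbabilityMeasure_preWienerMeasure'
  have hψc : Continuous ψ := continuous_iff_continuousAt.2 fun t ↦ (hψ t).continuousAt
  have hψm : Measurable ψ := hψc.measurable
  have hψ'm : Measurable ψ' := hψ'c.measurable
  have hfin : ∀ᵐ ω ∂preWienerMeasure, ρ ω ≠ ⊤ := ae_ne_top_of_le_sleExitLevel hκ hρσ
  -- the random time `R = ρ` read in `ℝ`
  set R : (ℝ≥0 → ℝ) → ℝ := fun ω ↦ (((ρ ω).untopA : ℝ≥0) : ℝ) with hRdef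
  have hRm : Measurable R := hρ.measurable'.untopA.coe_nnreal_real
  have hR0 : ∀ ω, 0 ≤ R ω := fun ω ↦ NNReal.coe_nonneg _
  have hRi : Integrable R preWienerMeasure := integrable_untopA_of_le_sleExitLevel hκ hρ hρσ
  -- (1) Fubini for the left side
  set a := topExpect κ ψ' with ha
  have ham : Measurable a := measurable_topExpect κ hψ'm
  have hab : ∀ y, |a y| ≤ C' := abs_topExpect_le κ hψ'b
  have hφm : Measurable (Function.uncurry fun (ω : ℝ≥0 → ℝ) (v : ℝ) ↦ a (sleArgLevel κ n θ v.toNNReal ω)) :=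
    ham.comp (measurable_sleArgLevel_toNNReal_uncurry κ n θ)
  obtain ⟨-, h1⟩ := integral_intervalIntegral_eq_integral_integral hRm hR0 hRi hφm
    (fun ω v ↦ hab _)
  rw [h1]
  -- (2) Fubini for the right side: `φ₂(ω, v) = 1_{Y_T = 2π} ψ'(T - v)`
  set S := sleExitsTop κ θ with hS
  have hSm : MeasurableSet S := measurableSet_sleExitsTop κ θ
  have hφ₂m : Measurable (Function.uncurry fun (ω : ℝ≥0 → ℝ) (v : ℝ) ↦
      S.indicator (fun ω ↦ ψ' (sleLifetimeReal κ θ ω - v)) ω) := by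
    have h1 : Measurable fun p : (ℝ≥0 → ℝ) × ℝ ↦ ψ' (sleLifetimeReal κ θ p.1 - p.2) :=
      hψ'm.comp (((measurable_sleLifetimeReal κ θ).comp measurable_fst).sub measurable_snd)
    have h2 : Measurable fun p : (ℝ≥0 → ℝ) × ℝ ↦ S.indicator (1 : (ℝ≥0 → ℝ) → ℝ) p.1 :=
      (measurable_one.indicator hSm).comp measurable_fst
    have heq : (Function.uncurry fun (ω : ℝ≥0 → ℝ) (v : ℝ) ↦
        S.indicator (fun ω ↦ ψ' (sleLifetimeReal κ θ ω - v)) ω) =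
        fun p ↦ S.indicator (1 : (ℝ≥0 → ℝ) → ℝ) p.1 * ψ' (sleLifetimeReal κ θ p.1 - p.2) := by
      funext p
      simp only [Function.uncurry]
      by_cases hp : p.1 ∈ S
      · rw [indicator_of_mem hp, indicator_of_mem hp]; simp
      · rw [indicator_of_notMem hp, indicator_of_notMem hp]; simp
    rw [heq]
    exact h2.mul h1
  have hC' : 0 ≤ C' := (abs_nonneg _).trans (hψ'b 0)
  have hφ₂b : ∀ (ω : ℝ≥0 → ℝ) (v : ℝ), |S.indicator (fun ω ↦ ψ' (sleLifetimeReal κ θ ω - v)) ω| ≤ C' := by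
    intro ω v
    by_cases hω : ω ∈ S
    · rw [indicator_of_mem hω]; exact hψ'b _
    · rw [indicator_of_notMem hω, abs_zero]; exact hC'
  obtain ⟨-, h2⟩ := integral_intervalIntegral_eq_integral_integral hRm hR0 hRi hφ₂m hφ₂b
  -- (3) the two `v`-integrands agree for every `v`: fixed-time strong Markov property
  have hv : ∀ v : ℝ, ∫ ω, (Ioo 0 (R ω)).indicator (fun v ↦ a (sleArgLevel κ n θ v.toNNReal ω)) v
      ∂preWienerMeasure =
      ∫ ω, (Ioo 0 (R ω)).indicator (fun v ↦ S.indicator (fun ω ↦ ψ' (sleLifetimeReal κ θ ω - v)) ω) v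
        ∂preWienerMeasure := by
    intro v
    rcases le_or_gt v 0 with hv0 | hv0
    · have hz : ∀ ω, v ∉ Ioo 0 (R ω) := fun ω h ↦ absurd h.1 (not_lt.2 hv0)
      simp only [indicator_of_notMem (hz _)]
    · -- replace `{0 < v < R}` by `{v⁺ < ρ}` almost surely
      set A := {ω : ℝ≥0 → ℝ | ((v.toNNReal : ℝ≥0) : WithTop ℝ≥0) < ρ ω} with hA
      have hkey := integral_indicator_lt_mul_topExpect_eq hκ hθn hρ hρσ hψ'm hψ'b v.toNNReal
      have hl : (fun ω ↦ (Ioo 0 (R ω)).indicator (fun v ↦ a (sleArgLevel κ n θ v.toNNReal ω)) v)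
          =ᵐ[preWienerMeasure] fun ω ↦ A.indicator 1 ω * a (sleArgLevel κ n θ v.toNNReal ω) := by
        filter_upwards [hfin] with ω hω
        obtain ⟨r, hr⟩ := WithTop.ne_top_iff_exists.1 hω
        by_cases hωA : ω ∈ A
        · have hvR : v ∈ Ioo 0 (R ω) := ⟨hv0, (lt_untopA_iff hr.symm hv0).2 hωA⟩
          rw [indicator_of_mem hvR, indicator_of_mem hωA]; simp
        · have hvR : v ∉ Ioo 0 (R ω) := fun h ↦ hωA ((lt_untopA_iff hr.symm hv0).1 h.2)
          rw [indicator_of_notMem hvR, indicator_of_notMem hωA]; simp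
      have hr' : (fun ω ↦ (Ioo 0 (R ω)).indicator
          (fun v ↦ S.indicator (fun ω ↦ ψ' (sleLifetimeReal κ θ ω - v)) ω) v)
          =ᵐ[preWienerMeasure] fun ω ↦ A.indicator 1 ω *
            S.indicator (fun ω ↦ ψ' (sleLifetimeReal κ θ ω - v.toNNReal)) ω := by
        filter_upwards [hfin] with ω hω
        obtain ⟨r, hr⟩ := WithTop.ne_top_iff_exists.1 hω
        rw [Real.coe_toNNReal _ hv0.le]
        by_cases hωA : ω ∈ A
        · have hvR : v ∈ Ioo 0 (R ω) := ⟨hv0, (lt_untopA_iff hr.symm hv0).2 hωA⟩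
          rw [indicator_of_mem hvR, indicator_of_mem hωA]; simp
        · have hvR : v ∉ Ioo 0 (R ω) := fun h ↦ hωA ((lt_untopA_iff hr.symm hv0).1 h.2)
          rw [indicator_of_notMem hvR, indicator_of_notMem hωA]; simp
      rw [integral_congr_ae hl, integral_congr_ae hr', hkey]
  simp_rw [hv]
  rw [← h2]
  -- (4) the fundamental theorem of calculus, pathwise
  have hftc : ∀ ω, ∫ v in (0 : ℝ)..R ω, S.indicator (fun ω ↦ ψ' (sleLifetimeReal κ θ ω - v)) ω =
      S.indicator (fun ω ↦ ψ (sleLifetimeReal κ θ ω) - ψ (sleLifetimeReal κ θ ω - R ω)) ω := by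
    intro ω
    by_cases hω : ω ∈ S
    · simp only [indicator_of_mem hω]
      rw [intervalIntegral.integral_comp_sub_left (fun u ↦ ψ' u) (sleLifetimeReal κ θ ω), sub_zero]
      rw [intervalIntegral.integral_eq_sub_of_hasDerivAt (fun u _ ↦ hψ u)
        (hψ'c.intervalIntegrable _ _)]
    · simp only [indicator_of_notMem hω, intervalIntegral.integral_zero]
  simp_rw [hftc]
  -- (5) split and use the mean-value property
  have hi1 : Integrable (fun ω ↦ S.indicator (fun ω ↦ ψ (sleLifetimeReal κ θ ω)) ω) preWienerMeasure := by
    refine (integrable_const C).mono' ?_ (Eventually.of_forall fun ω ↦ ?_)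
    · exact ((hψm.comp (measurable_sleLifetimeReal κ θ)).indicator hSm).aestronglyMeasurable
    · rw [Real.norm_eq_abs]
      by_cases hω : ω ∈ S
      · rw [indicator_of_mem hω]; exact hψb _
      · rw [indicator_of_notMem hω, abs_zero]; exact (abs_nonneg _).trans (hψb 0)
  have hi2 : Integrable (fun ω ↦ S.indicator (fun ω ↦ ψ (sleLifetimeReal κ θ ω - R ω)) ω)
      preWienerMeasure := by
    refine (integrable_const C).mono' ?_ (Eventually.of_forall fun ω ↦ ?_)
    · exact ((hψm.comp ((measurable_sleLifetimeReal κ θ).sub hRm)).indicator hSm).aestronglyMeasurable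
    · rw [Real.norm_eq_abs]
      by_cases hω : ω ∈ S
      · rw [indicator_of_mem hω]; exact hψb _
      · rw [indicator_of_notMem hω, abs_zero]; exact (abs_nonneg _).trans (hψb 0)
  have hsplit : ∀ ω, S.indicator (fun ω ↦ ψ (sleLifetimeReal κ θ ω) - ψ (sleLifetimeReal κ θ ω - R ω)) ω =
      S.indicator (fun ω ↦ ψ (sleLifetimeReal κ θ ω)) ω -
        S.indicator (fun ω ↦ ψ (sleLifetimeReal κ θ ω - R ω)) ω := by
    intro ω
    by_cases hω : ω ∈ S
    · simp only [indicator_of_mem hω]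
    · simp only [indicator_of_notMem hω, sub_zero]
  simp_rw [hsplit]
  rw [integral_sub hi1 hi2, integral_topExpect_stoppedValue_eq hκ hθn hρ hρσ hψm hψb]
  rfl

end Top

section Bot

variable (hκ : 4 < κ) (hθn : θ ∈ Ioo (2 * level n) (2 * Real.pi - 2 * level n))
  {ρ : (ℝ≥0 → ℝ) → WithTop ℝ≥0} (hρ : IsStoppingTime brownianFiltration ρ)
  (hρσ : ∀ ω, ρ ω ≤ sleExitLevel κ n θ ω)
include hκ hθn hρ hρσ

/-- **Fixed-time strong Markov property, bottom exit**: for `v ≥ 0` and bounded measurable `ψ`,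
`E[b_ψ(Y_v); v < ρ] = E[ψ(T - v); Y_T = 0, v < ρ]` (the strong Markov property at `ρ ∧ v` with
the `𝓕_{ρ∧v}`-event `{v < ρ}`). [cite: LawlerSchrammWernerEJP2002, §2 (2.10)] -/
theorem integral_indicator_lt_mul_botExpect_eq {ψ : ℝ → ℝ} (hψm : Measurable ψ) {C : ℝ}
    (hψb : ∀ t, |ψ t| ≤ C) (v : ℝ≥0) :
    ∫ ω, {ω | (v : WithTop ℝ≥0) < ρ ω}.indicator 1 ω * botExpect κ ψ (sleArgLevel κ n θ v ω)
        ∂preWienerMeasure =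
      ∫ ω, {ω | (v : WithTop ℝ≥0) < ρ ω}.indicator 1 ω *
        (sleExitsBot κ θ).indicator (fun ω ↦ ψ (sleLifetimeReal κ θ ω - v)) ω ∂preWienerMeasure := by
  have hρv := hρ.min_const v
  have hρvσ : ∀ ω, min (ρ ω) v ≤ sleExitLevel κ n θ ω := fun ω ↦ (min_le_left _ _).trans (hρσ ω)
  set A := {ω : ℝ≥0 → ℝ | (v : WithTop ℝ≥0) < ρ ω} with hA
  have hG : Measurable[hρv.measurableSpace] (A.indicator fun _ : ℝ≥0 → ℝ ↦ (1 : ℝ)) :=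
    (measurable_const (a := (1 : ℝ))).indicator (measurableSet_lt_min_const hρ v)
  have hGb : ∀ ω, |A.indicator (fun _ : ℝ≥0 → ℝ ↦ (1 : ℝ)) ω| ≤ 1 := fun ω ↦ by
    by_cases h : ω ∈ A
    · rw [indicator_of_mem h]; simp
    · rw [indicator_of_notMem h]; simp
  have h := integral_mul_indicator_exitsBot_comp_sub_eq hκ hθn hρv hρvσ hG hGb hψm hψb
  -- identify both integrands on `A` (off `A` they vanish)
  have hL : ∀ ω, A.indicator (fun _ : ℝ≥0 → ℝ ↦ (1 : ℝ)) ω * (sleExitsBot κ θ).indicator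
      (fun ω ↦ ψ (sleLifetimeReal κ θ ω - (((min (ρ ω) v).untopA : ℝ≥0) : ℝ))) ω =
      A.indicator 1 ω * (sleExitsBot κ θ).indicator (fun ω ↦ ψ (sleLifetimeReal κ θ ω - v)) ω := by
    intro ω
    by_cases hω : ω ∈ A
    · have hmin : min (ρ ω) v = (v : WithTop ℝ≥0) := min_eq_right (le_of_lt hω)
      by_cases hS : ω ∈ sleExitsBot κ θ
      · rw [indicator_of_mem hS, indicator_of_mem hS, coe_untopA_of_eq_coe hmin]; rfl
      · rw [indicator_of_notMem hS, indicator_of_notMem hS]; rfl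
    · rw [indicator_of_notMem hω, indicator_of_notMem hω, zero_mul, zero_mul]
  have hR : ∀ ω, A.indicator (fun _ : ℝ≥0 → ℝ ↦ (1 : ℝ)) ω *
      botExpect κ ψ (stoppedValue (sleArgLevel κ n θ) (fun ω ↦ min (ρ ω) v) ω) =
      A.indicator 1 ω * botExpect κ ψ (sleArgLevel κ n θ v ω) := by
    intro ω
    by_cases hω : ω ∈ A
    · have hmin : min (ρ ω) v = (v : WithTop ℝ≥0) := min_eq_right (le_of_lt hω)
      have : stoppedValue (sleArgLevel κ n θ) (fun ω ↦ min (ρ ω) v) ω = sleArgLevel κ n θ v ω := by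
        rw [stoppedValue]
        simp only [hmin]
        rfl
      rw [this]; rfl
    · rw [indicator_of_notMem hω, indicator_of_notMem hω, zero_mul, zero_mul]
  simp_rw [hL, hR] at h
  exact h.symm

/-- **Mean-value property, bottom exit**: `E[b_ψ(Y_ρ)] = E[ψ(T - ρ); Y_T = 0]` for a stopping time
`ρ ≤ σₙ(θ)` (the conditional law of `(T - ρ, 1_{Y_T = 0})` given `𝓕_ρ` is that of `(T, 1_{Y_T = 0})`
under `P^{Y_ρ}`; LSW (2002), (2.10) with `t = 0`). [cite: LawlerSchrammWernerEJP2002, §2 (2.10)] -/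
theorem integral_botExpect_stoppedValue_eq {ψ : ℝ → ℝ} (hψm : Measurable ψ) {C : ℝ}
    (hψb : ∀ t, |ψ t| ≤ C) :
    ∫ ω, botExpect κ ψ (stoppedValue (sleArgLevel κ n θ) ρ ω) ∂preWienerMeasure =
      ∫ ω, (sleExitsBot κ θ).indicator
        (fun ω ↦ ψ (sleLifetimeReal κ θ ω - ((ρ ω).untopA : ℝ≥0))) ω ∂preWienerMeasure := by
  have hG : Measurable[hρ.measurableSpace] (fun _ : ℝ≥0 → ℝ ↦ (1 : ℝ)) := measurable_const (a := (1 : ℝ))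
  have h := integral_mul_indicator_exitsBot_comp_sub_eq hκ hθn hρ hρσ hG (C' := 1)
    (fun _ ↦ by simp) hψm hψb
  simp only [one_mul] at h
  exact h.symm

/-- **Dynkin's formula for `b_ψ`, bottom exit.** For `ψ ∈ C¹(ℝ)` with `ψ` and `ψ'` bounded (`ψ'`
continuous) and a stopping time `ρ ≤ σₙ(θ)`,
`E[∫₀^ρ b_{ψ'}(Y_v) dv] = a_ψ(θ) - E[b_ψ(Y_ρ)]`, where `b_φ(y) = E^y[φ(T); Y_T = 0]`. Proof: Fubini
in `(ω, v)`; for fixed `v`, `E[b_{ψ'}(Y_v); v < ρ] = E[ψ'(T - v); Y_T = 0, v < ρ]` (fixed-time strong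
Markov property); Fubini back and `∫₀^ρ ψ'(T - v) dv = ψ(T) - ψ(T - ρ)`; finally the mean-value
property `E[ψ(T - ρ); Y_T = 0] = E[b_ψ(Y_ρ)]`. This is the integrated form of LSW's PDE (2.4) in
the space variable for `h = b_ψ`, with no regularity of `b_ψ` assumed.
[cite: LawlerSchrammWernerEJP2002, §2 proof of Lemma 2.2] -/
theorem integral_intervalIntegral_botExpect_eq {ψ ψ' : ℝ → ℝ} (hψ : ∀ t, HasDerivAt ψ (ψ' t) t)
    (hψ'c : Continuous ψ') {C C' : ℝ} (hψb : ∀ t, |ψ t| ≤ C) (hψ'b : ∀ t, |ψ' t| ≤ C') :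
    ∫ ω, (∫ v in (0 : ℝ)..(((ρ ω).untopA : ℝ≥0) : ℝ), botExpect κ ψ' (sleArgLevel κ n θ v.toNNReal ω))
        ∂preWienerMeasure =
      botExpect κ ψ θ - ∫ ω, botExpect κ ψ (stoppedValue (sleArgLevel κ n θ) ρ ω) ∂preWienerMeasure := by
  haveI := isProbabilityMeasure_preWienerMeasure'
  have hψc : Continuous ψ := continuous_iff_continuousAt.2 fun t ↦ (hψ t).continuousAt
  have hψm : Measurable ψ := hψc.measurable
  have hψ'm : Measurable ψ' := hψ'c.measurable
  have hfin : ∀ᵐ ω ∂preWienerMeasure, ρ ω ≠ ⊤ := ae_ne_top_of_le_sleExitLevel hκ hρσ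
  -- the random time `R = ρ` read in `ℝ`
  set R : (ℝ≥0 → ℝ) → ℝ := fun ω ↦ (((ρ ω).untopA : ℝ≥0) : ℝ) with hRdef
  have hRm : Measurable R := hρ.measurable'.untopA.coe_nnreal_real
  have hR0 : ∀ ω, 0 ≤ R ω := fun ω ↦ NNReal.coe_nonneg _
  have hRi : Integrable R preWienerMeasure := integrable_untopA_of_le_sleExitLevel hκ hρ hρσ
  -- (1) Fubini for the left side
  set a := botExpect κ ψ' with ha
  have ham : Measurable a := measurable_botExpect κ hψ'm
  have hab : ∀ y, |a y| ≤ C' := abs_botExpect_le κ hψ'b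
  have hφm : Measurable (Function.uncurry fun (ω : ℝ≥0 → ℝ) (v : ℝ) ↦ a (sleArgLevel κ n θ v.toNNReal ω)) :=
    ham.comp (measurable_sleArgLevel_toNNReal_uncurry κ n θ)
  obtain ⟨-, h1⟩ := integral_intervalIntegral_eq_integral_integral hRm hR0 hRi hφm
    (fun ω v ↦ hab _)
  rw [h1]
  -- (2) Fubini for the right side: `φ₂(ω, v) = 1_{Y_T = 0} ψ'(T - v)`
  set S := sleExitsBot κ θ with hS
  have hSm : MeasurableSet S := measurableSet_sleExitsBot κ θ
  have hφ₂m : Measurable (Function.uncurry fun (ω : ℝ≥0 → ℝ) (v : ℝ) ↦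
      S.indicator (fun ω ↦ ψ' (sleLifetimeReal κ θ ω - v)) ω) := by
    have h1 : Measurable fun p : (ℝ≥0 → ℝ) × ℝ ↦ ψ' (sleLifetimeReal κ θ p.1 - p.2) :=
      hψ'm.comp (((measurable_sleLifetimeReal κ θ).comp measurable_fst).sub measurable_snd)
    have h2 : Measurable fun p : (ℝ≥0 → ℝ) × ℝ ↦ S.indicator (1 : (ℝ≥0 → ℝ) → ℝ) p.1 :=
      (measurable_one.indicator hSm).comp measurable_fst
    have heq : (Function.uncurry fun (ω : ℝ≥0 → ℝ) (v : ℝ) ↦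
        S.indicator (fun ω ↦ ψ' (sleLifetimeReal κ θ ω - v)) ω) =
        fun p ↦ S.indicator (1 : (ℝ≥0 → ℝ) → ℝ) p.1 * ψ' (sleLifetimeReal κ θ p.1 - p.2) := by
      funext p
      simp only [Function.uncurry]
      by_cases hp : p.1 ∈ S
      · rw [indicator_of_mem hp, indicator_of_mem hp]; simp
      · rw [indicator_of_notMem hp, indicator_of_notMem hp]; simp
    rw [heq]
    exact h2.mul h1
  have hC' : 0 ≤ C' := (abs_nonneg _).trans (hψ'b 0)
  have hφ₂b : ∀ (ω : ℝ≥0 → ℝ) (v : ℝ), |S.indicator (fun ω ↦ ψ' (sleLifetimeReal κ θ ω - v)) ω| ≤ C' := by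
    intro ω v
    by_cases hω : ω ∈ S
    · rw [indicator_of_mem hω]; exact hψ'b _
    · rw [indicator_of_notMem hω, abs_zero]; exact hC'
  obtain ⟨-, h2⟩ := integral_intervalIntegral_eq_integral_integral hRm hR0 hRi hφ₂m hφ₂b
  -- (3) the two `v`-integrands agree for every `v`: fixed-time strong Markov property
  have hv : ∀ v : ℝ, ∫ ω, (Ioo 0 (R ω)).indicator (fun v ↦ a (sleArgLevel κ n θ v.toNNReal ω)) v
      ∂preWienerMeasure =
      ∫ ω, (Ioo 0 (R ω)).indicator (fun v ↦ S.indicator (fun ω ↦ ψ' (sleLifetimeReal κ θ ω - v)) ω) v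
        ∂preWienerMeasure := by
    intro v
    rcases le_or_gt v 0 with hv0 | hv0
    · have hz : ∀ ω, v ∉ Ioo 0 (R ω) := fun ω h ↦ absurd h.1 (not_lt.2 hv0)
      simp only [indicator_of_notMem (hz _)]
    · -- replace `{0 < v < R}` by `{v⁺ < ρ}` almost surely
      set A := {ω : ℝ≥0 → ℝ | ((v.toNNReal : ℝ≥0) : WithTop ℝ≥0) < ρ ω} with hA
      have hkey := integral_indicator_lt_mul_botExpect_eq hκ hθn hρ hρσ hψ'm hψ'b v.toNNReal
      have hl : (fun ω ↦ (Ioo 0 (R ω)).indicator (fun v ↦ a (sleArgLevel κ n θ v.toNNReal ω)) v)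
          =ᵐ[preWienerMeasure] fun ω ↦ A.indicator 1 ω * a (sleArgLevel κ n θ v.toNNReal ω) := by
        filter_upwards [hfin] with ω hω
        obtain ⟨r, hr⟩ := WithTop.ne_top_iff_exists.1 hω
        by_cases hωA : ω ∈ A
        · have hvR : v ∈ Ioo 0 (R ω) := ⟨hv0, (lt_untopA_iff hr.symm hv0).2 hωA⟩
          rw [indicator_of_mem hvR, indicator_of_mem hωA]; simp
        · have hvR : v ∉ Ioo 0 (R ω) := fun h ↦ hωA ((lt_untopA_iff hr.symm hv0).1 h.2)
          rw [indicator_of_notMem hvR, indicator_of_notMem hωA]; simp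
      have hr' : (fun ω ↦ (Ioo 0 (R ω)).indicator
          (fun v ↦ S.indicator (fun ω ↦ ψ' (sleLifetimeReal κ θ ω - v)) ω) v)
          =ᵐ[preWienerMeasure] fun ω ↦ A.indicator 1 ω *
            S.indicator (fun ω ↦ ψ' (sleLifetimeReal κ θ ω - v.toNNReal)) ω := by
        filter_upwards [hfin] with ω hω
        obtain ⟨r, hr⟩ := WithTop.ne_top_iff_exists.1 hω
        rw [Real.coe_toNNReal _ hv0.le]
        by_cases hωA : ω ∈ A
        · have hvR : v ∈ Ioo 0 (R ω) := ⟨hv0, (lt_untopA_iff hr.symm hv0).2 hωA⟩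
          rw [indicator_of_mem hvR, indicator_of_mem hωA]; simp
        · have hvR : v ∉ Ioo 0 (R ω) := fun h ↦ hωA ((lt_untopA_iff hr.symm hv0).1 h.2)
          rw [indicator_of_notMem hvR, indicator_of_notMem hωA]; simp
      rw [integral_congr_ae hl, integral_congr_ae hr', hkey]
  simp_rw [hv]
  rw [← h2]
  -- (4) the fundamental theorem of calculus, pathwise
  have hftc : ∀ ω, ∫ v in (0 : ℝ)..R ω, S.indicator (fun ω ↦ ψ' (sleLifetimeReal κ θ ω - v)) ω =
      S.indicator (fun ω ↦ ψ (sleLifetimeReal κ θ ω) - ψ (sleLifetimeReal κ θ ω - R ω)) ω := by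
    intro ω
    by_cases hω : ω ∈ S
    · simp only [indicator_of_mem hω]
      rw [intervalIntegral.integral_comp_sub_left (fun u ↦ ψ' u) (sleLifetimeReal κ θ ω), sub_zero]
      rw [intervalIntegral.integral_eq_sub_of_hasDerivAt (fun u _ ↦ hψ u)
        (hψ'c.intervalIntegrable _ _)]
    · simp only [indicator_of_notMem hω, intervalIntegral.integral_zero]
  simp_rw [hftc]
  -- (5) split and use the mean-value property
  have hi1 : Integrable (fun ω ↦ S.indicator (fun ω ↦ ψ (sleLifetimeReal κ θ ω)) ω) preWienerMeasure := by
    refine (integrable_const C).mono' ?_ (Eventually.of_forall fun ω ↦ ?_)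
    · exact ((hψm.comp (measurable_sleLifetimeReal κ θ)).indicator hSm).aestronglyMeasurable
    · rw [Real.norm_eq_abs]
      by_cases hω : ω ∈ S
      · rw [indicator_of_mem hω]; exact hψb _
      · rw [indicator_of_notMem hω, abs_zero]; exact (abs_nonneg _).trans (hψb 0)
  have hi2 : Integrable (fun ω ↦ S.indicator (fun ω ↦ ψ (sleLifetimeReal κ θ ω - R ω)) ω)
      preWienerMeasure := by
    refine (integrable_const C).mono' ?_ (Eventually.of_forall fun ω ↦ ?_)
    · exact ((hψm.comp ((measurable_sleLifetimeReal κ θ).sub hRm)).indicator hSm).aestronglyMeasurable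
    · rw [Real.norm_eq_abs]
      by_cases hω : ω ∈ S
      · rw [indicator_of_mem hω]; exact hψb _
      · rw [indicator_of_notMem hω, abs_zero]; exact (abs_nonneg _).trans (hψb 0)
  have hsplit : ∀ ω, S.indicator (fun ω ↦ ψ (sleLifetimeReal κ θ ω) - ψ (sleLifetimeReal κ θ ω - R ω)) ω =
      S.indicator (fun ω ↦ ψ (sleLifetimeReal κ θ ω)) ω -
        S.indicator (fun ω ↦ ψ (sleLifetimeReal κ θ ω - R ω)) ω := by
    intro ω
    by_cases hω : ω ∈ S
    · simp only [indicator_of_mem hω]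
    · simp only [indicator_of_notMem hω, sub_zero]
  simp_rw [hsplit]
  rw [integral_sub hi1 hi2, integral_botExpect_stoppedValue_eq hκ hθn hρ hρσ hψm hψb]
  rfl

end Bot

end RadialLoewner

end Literature.Probability.RandomPlanarGeometry
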